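import Mathlib
import HarnessLib
import Literature.Probability.LatticeModels.LatticeGraph
import Summits.HubbardSuperconductivity.HubbardSuperconductivity.Theorems.BalabanIRBirComplexStableXYChainKernel
import Summits.HubbardSuperconductivity.HubbardSuperconductivity.Theorems.BalabanIRBirComplexStableXYTraceFormula
import Summits.HubbardSuperconductivity.HubbardSuperconductivity.Theorems.BalabanIRBirComplexStableXYSlicing

/-!
# BalabanIR engine `BirComplexStableXY` (stmt-HubbardSuperconductivity-2080): positivity of the
partition function at even temporal extent in the time-reflection class (`r = 2`)

Support theorems for crux 2 of route BalabanIR (`--supports stmt-HubbardSuperconductivity-2080`).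
The item record asks for the engine to be RESTATED with the time-reflection reality hypothesis

  (R)  `F (φ ∘ R) = conj (F φ)`,  `R (w₁, w₂, w₃) = (w₁, w₂, rev w₃)`,

after the Beraha–Kahane–Weiss zeros of `Z` found for the typed class (refuter 702958a1, cdisprove
`Disproof.lean`).  Under (R) alone `Z` is real (`partitionFunction_conj_eq_self`), so zeros can still
occur as sign changes; the only remaining disagreement on the item (ideator-3 vs ideators 1/2) is
whether such sign changes occur (odd temporal extent `M`, equimodular NEGATIVE transfer
eigenvalue).  This file settles the EVEN-`M` half unconditionally, for windows of temporal range
two (`r = 2`), for EVERY real coupling `K`, every `L` and every Fourier table `c` satisfying (R) — no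
smallness, no coercivity, no `K₀, L₀`:

* `birEven_partitionFunction_pos` — for even `M ≥ 2` the typed partition function
  `Z = ∫_{[0,2π]^Λ} exp(-A θ) dθ` (same `sh`, `F`, `A`, `cube` as the route file, `r = 2`) is a
  real number `> 0`; in particular `Z ≠ 0` (first conjunct of the engine);
* `birEven_positiveDensity` — moreover there is a continuous density `ρ ≥ 0` on the slice
  configuration space `X = (TorusSite 2 L → ℝ)`, strictly positive on the slice cube, with
  `Z = ∫_{[0,2π]^X} ρ` and `∫ O·exp(-A) = ∫_{[0,2π]^X} O_slice · ρ`: at even `M` the complex engine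
  measure, tested against slice observables, IS a positive measure — the slice-order claim
  `Re (∫ O e^{-A} / Z) ≥ 1/2` becomes the honest expectation bound `𝔼_ρ [O_slice] ≥ 1/2`
  (`birEven_sliceOrder_iff`), with `0 ≤ ∫ O e^{-A} ≤ Z` for free.

Mechanism (no operator theory; files `…ChainKernel`, `…TraceFormula`, `…Slicing`): for `r = 2` the weight
factorises over consecutive slices, `exp(-A θ) = ∏_τ k(θ_τ, θ_{τ+1})` (`birAction_factorises`),
with a continuous bounded nowhere-zero kernel which (R) makes HERMITIAN,
`k(η', η) = conj k(η, η')` (`birKernel_herm`); currying the cube (`birCurry_measurePreserving`) and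
the cyclic trace formula give `Z_M = ∫ G_{M-1}(a,a) da`, and for `M = 2j+2` the diagonal
`G_{2j+1}(a,a) = ∫ ‖G_j(a,c)‖² dc` is strictly positive (`birChain_integral_diag_pos`).  So in the
(R) class Lee–Yang/BKW zeros of the engine can only sit at ODD `M`; restating the crux with (R) and
even `M` (the `β → ∞` dictionary of crux 4 is free to use even Trotter numbers) makes its first
conjunct a theorem for `r = 2`.
-/

namespace Summit.HubbardSuperconductivity.HubbardSuperconductivity.Theorems

open scoped BigOperators ComplexConjugate
open MeasureTheory
open Literature.Probability.LatticeModels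

section Main

/-- **Positive-density representation at even temporal extent (`r = 2`, class (R)).** For the
objects of `BirComplexStableXY` with `r = 2` (same `sh`, `F`, `A`, `cube`, `Z`, `O` as the route
file), every real `K`, every `L ≥ 1`, every Fourier table satisfying the time-reflection reality
hypothesis (R) and every EVEN `M ≥ 1`: there is a continuous density `ρ ≥ 0` on the slice
configurations, strictly positive on the slice cube `[0,2π]^X`, with
`Z = ∫_{[0,2π]^X} ρ > 0` and `∫ O e^{-A} = ∫_{[0,2π]^X} O_slice ρ`
(`ρ(a) = Re G_{M-1}(a,a) = ∫ ‖G_{M/2-1}(a,c)‖² dc`, the diagonal of the Hermitian chain kernel). -/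
theorem birEven_positiveDensity (c : ((Fin 2 × Fin 2 × Fin 2) → ℤ) →₀ ℂ) (K : ℝ) (L M : ℕ)
    [NeZero L] [NeZero M]
    (hR : ∀ φ : (Fin 2 × Fin 2 × Fin 2) → ℝ,
      c.sum (fun n a => a * Complex.exp (Complex.I *
        ((∑ w, (n w : ℝ) * φ (w.1, w.2.1, Fin.rev w.2.2) : ℝ) : ℂ))) =
      conj (c.sum (fun n a => a * Complex.exp (Complex.I * ((∑ w, (n w : ℝ) * φ w : ℝ) : ℂ)))))
    (hM : Even M) :
    let sh : (TorusSite 2 L × ZMod M) → (Fin 2 × Fin 2 × Fin 2) → (TorusSite 2 L × ZMod M) :=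
      fun s w => (s.1 + ![((w.1 : ℕ) : ZMod L), ((w.2.1 : ℕ) : ZMod L)], s.2 + ((w.2.2 : ℕ) : ZMod M))
    let F : ((Fin 2 × Fin 2 × Fin 2) → ℝ) → ℂ := fun φ =>
      c.sum (fun n a => a * Complex.exp (Complex.I * ((∑ w, (n w : ℝ) * φ w : ℝ) : ℂ)))
    let A : ((TorusSite 2 L × ZMod M) → ℝ) → ℂ := fun θ => (K : ℂ) * ∑ s, F (fun w => θ (sh s w))
    let cube : Set ((TorusSite 2 L × ZMod M) → ℝ) := Set.pi Set.univ (fun _ => Set.Icc (0:ℝ) (2 * Real.pi))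
    let Z : ℂ := MeasureTheory.integral (MeasureTheory.volume.restrict cube) (fun θ => Complex.exp (-(A θ)))
    let O : ((TorusSite 2 L × ZMod M) → ℝ) → ℝ := fun θ =>
      ‖∑ x : TorusSite 2 L, Complex.exp (Complex.I * (θ (x, 0) : ℂ))‖ ^ 2 / (L : ℝ) ^ 4
    let N : ℂ := MeasureTheory.integral (MeasureTheory.volume.restrict cube)
      (fun θ => (O θ : ℂ) * Complex.exp (-(A θ)))
    ∃ ρ : (TorusSite 2 L → ℝ) → ℝ, Continuous ρ ∧ (∀ a, 0 ≤ ρ a) ∧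
      (∀ a ∈ Set.pi Set.univ (fun _ : TorusSite 2 L => Set.Icc (0:ℝ) (2 * Real.pi)), 0 < ρ a) ∧
      Z = ((∫ a in Set.pi Set.univ (fun _ : TorusSite 2 L => Set.Icc (0:ℝ) (2 * Real.pi)), ρ a : ℝ) : ℂ) ∧
      N = ((∫ a in Set.pi Set.univ (fun _ : TorusSite 2 L => Set.Icc (0:ℝ) (2 * Real.pi)),
        ‖∑ x : TorusSite 2 L, Complex.exp (Complex.I * (a x : ℂ))‖ ^ 2 / (L : ℝ) ^ 4 * ρ a : ℝ) : ℂ) ∧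
      0 < ∫ a in Set.pi Set.univ (fun _ : TorusSite 2 L => Set.Icc (0:ℝ) (2 * Real.pi)), ρ a := by
  -- `M = 2j + 2`
  obtain ⟨j, rfl⟩ : ∃ j, M = 2 * j + 1 + 1 := by
    obtain ⟨t, ht⟩ := hM
    have h0 : M ≠ 0 := NeZero.ne M
    exact ⟨t - 1, by omega⟩
  intro sh F A cube Z O N
  -- the slice cube and its (finite, Lebesgue) measure
  set CX : Set (TorusSite 2 L → ℝ) :=
    Set.pi Set.univ (fun _ : TorusSite 2 L => Set.Icc (0:ℝ) (2 * Real.pi)) with hCX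
  set μ : Measure (TorusSite 2 L → ℝ) := volume.restrict CX with hμ
  have hCXm : MeasurableSet CX := MeasurableSet.univ_pi fun _ => measurableSet_Icc
  have hCXc : IsCompact CX := isCompact_univ_pi fun _ => isCompact_Icc
  haveI : IsFiniteMeasure μ := isFiniteMeasure_restrict.mpr hCXc.measure_lt_top.ne
  have hS : ∀ a ∈ CX, ∀ U : Set (TorusSite 2 L → ℝ), IsOpen U → a ∈ U → 0 < μ U :=
    fun a ha U hU haU => birSliceCube_nhds_pos a ha U hU haU
  have hSae : ∀ᵐ a ∂μ, a ∈ CX := ae_restrict_mem hCXm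
  have hμpos : 0 < μ Set.univ := by
    have h0 : (fun _ : TorusSite 2 L => (0:ℝ)) ∈ CX := by
      intro i _
      exact ⟨le_rfl, by positivity⟩
    exact hS _ h0 Set.univ isOpen_univ (Set.mem_univ _)
  -- the local generating function and the two-slice kernel
  obtain ⟨hFc, hFb⟩ := birLocalF_continuous_bound c
  have hFc' : Continuous F := hFc
  have hFb' : ∀ φ, ‖F φ‖ ≤ ∑ n ∈ c.support, ‖c n‖ := hFb
  have hRF : ∀ φ : (Fin 2 × Fin 2 × Fin 2) → ℝ,
      F (fun w => φ (w.1, w.2.1, Fin.rev w.2.2)) = conj (F φ) := hR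
  set k : (TorusSite 2 L → ℝ) → (TorusSite 2 L → ℝ) → ℂ := fun η η' =>
    Complex.exp (-((K : ℂ) * ∑ x : TorusSite 2 L, F (fun w =>
      (![η, η'] w.2.2) (x + ![((w.1 : ℕ) : ZMod L), ((w.2.1 : ℕ) : ZMod L)])))) with hk
  obtain ⟨hkc, hkb, hkne⟩ := birKernel_continuous_bound (L := L) F hFc' hFb' K
  have hkc' : Continuous (Function.uncurry k) := hkc
  have hkR : ∀ η η', ‖k η η'‖ ≤
      Real.exp (|K| * (Fintype.card (TorusSite 2 L) * ∑ n ∈ c.support, ‖c n‖)) := hkb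
  have hkne' : ∀ η η', k η η' ≠ 0 := hkne
  have hkh : ∀ η η', k η' η = conj (k η η') := fun η η' => birKernel_herm F hRF K η η'
  -- the chain kernels `G n` (kernels of `T^(n+1)`), by recursion
  let G : ℕ → (TorusSite 2 L → ℝ) → (TorusSite 2 L → ℝ) → ℂ := fun n =>
    Nat.rec (motive := fun _ => (TorusSite 2 L → ℝ) → (TorusSite 2 L → ℝ) → ℂ) k
      (fun _ g a b => ∫ c', g a c' * k c' b ∂μ) n
  have hG0 : ∀ a b, G 0 a b = k a b := fun _ _ => rfl
  have hGs : ∀ n a b, G (n + 1) a b = ∫ c', G n a c' * k c' b ∂μ := fun _ _ _ => rfl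
  -- currying the cube and the trace formulas
  obtain ⟨e, he, hmp⟩ := birCurry_measurePreserving L (2 * j + 1 + 1)
  have hfac : ∀ σ : ZMod (2 * j + 1 + 1) → TorusSite 2 L → ℝ,
      Complex.exp (-(A (e σ))) = ∏ τ, k (σ τ) (σ (τ + 1)) := by
    intro σ
    rw [he σ]
    exact birAction_factorises c K L (2 * j + 1 + 1) σ
  -- slice observable
  obtain ⟨hOc, hOb⟩ := birSliceObservable_continuous_bound L
  have hOe : ∀ σ : ZMod (2 * j + 1 + 1) → TorusSite 2 L → ℝ,
      O (e σ) = ‖∑ x : TorusSite 2 L, Complex.exp (Complex.I * (σ 0 x : ℂ))‖ ^ 2 / (L : ℝ) ^ 4 := by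
    intro σ
    rw [he σ]
  have hZ : Z = ∫ a, G (2 * j + 1) a a ∂μ := by
    have h1 := hmp.integral_comp' (fun θ => Complex.exp (-(A θ)))
    have h3 := birChain_integral_cyclic (μ := μ) hkc' hkR hG0 hGs (f := fun _ => (1 : ℂ))
      continuous_const (Cf := 1) (fun _ => by simp) (2 * j + 1)
    simp only [one_mul] at h3
    calc Z = ∫ θ, Complex.exp (-(A θ)) ∂(volume.restrict cube) := rfl
      _ = ∫ σ, Complex.exp (-(A (e σ))) ∂(Measure.pi fun _ => μ) := h1.symm
      _ = ∫ σ : ZMod (2 * j + 1 + 1) → TorusSite 2 L → ℝ, ∏ τ : ZMod (2 * j + 1 + 1),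
            k (σ τ) (σ (τ + 1)) ∂(Measure.pi fun _ => μ) := by simp_rw [hfac]
      _ = ∫ a, G (2 * j + 1) a a ∂μ := h3
  have hN : N = ∫ a, ((‖∑ x : TorusSite 2 L, Complex.exp (Complex.I * (a x : ℂ))‖ ^ 2 /
      (L : ℝ) ^ 4 : ℝ) : ℂ) * G (2 * j + 1) a a ∂μ := by
    have h1 := hmp.integral_comp' (fun θ => (O θ : ℂ) * Complex.exp (-(A θ)))
    have hfC : Continuous (fun a : TorusSite 2 L → ℝ =>
        ((‖∑ x : TorusSite 2 L, Complex.exp (Complex.I * (a x : ℂ))‖ ^ 2 / (L : ℝ) ^ 4 : ℝ) : ℂ)) :=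
      Complex.continuous_ofReal.comp hOc
    have hfB : ∀ a : TorusSite 2 L → ℝ,
        ‖((‖∑ x : TorusSite 2 L, Complex.exp (Complex.I * (a x : ℂ))‖ ^ 2 / (L : ℝ) ^ 4 : ℝ) : ℂ)‖
          ≤ 1 := by
      intro a
      rw [Complex.norm_real, Real.norm_of_nonneg (hOb a).1]
      exact (hOb a).2
    have h3 := birChain_integral_cyclic (μ := μ) hkc' hkR hG0 hGs hfC (Cf := 1) hfB (2 * j + 1)
    calc N = ∫ θ, (O θ : ℂ) * Complex.exp (-(A θ)) ∂(volume.restrict cube) := rfl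
      _ = ∫ σ, (O (e σ) : ℂ) * Complex.exp (-(A (e σ))) ∂(Measure.pi fun _ => μ) := h1.symm
      _ = ∫ σ : ZMod (2 * j + 1 + 1) → TorusSite 2 L → ℝ,
            ((‖∑ x : TorusSite 2 L, Complex.exp (Complex.I * (σ 0 x : ℂ))‖ ^ 2 /
              (L : ℝ) ^ 4 : ℝ) : ℂ) * ∏ τ : ZMod (2 * j + 1 + 1), k (σ τ) (σ (τ + 1))
            ∂(Measure.pi fun _ => μ) := by
          simp_rw [hfac, hOe]
      _ = _ := h3
  -- positivity of the diagonal
  obtain ⟨hint, hpos⟩ :=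
    birChain_integral_diag_pos (μ := μ) hkc' hkR hG0 hGs hkh hkne' hS hSae hμpos j
  have hdiag : ∀ a, G (2 * j + 1) a a = (((G (2 * j + 1) a a).re : ℝ) : ℂ) := by
    intro a
    rw [birChain_diag_re_eq hkc' hkR hG0 hGs hkh j a]
    exact birChain_diag_eq hkc' hkR hG0 hGs hkh j a
  refine ⟨fun a => (G (2 * j + 1) a a).re, ?_, ?_, ?_, ?_, ?_, hpos⟩
  · exact Complex.continuous_re.comp ((birChain_continuous hkc' hkR hG0 hGs (2 * j + 1)).comp
      (continuous_id.prodMk continuous_id))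
  · intro a
    show 0 ≤ (G (2 * j + 1) a a).re
    rw [birChain_diag_re_eq hkc' hkR hG0 hGs hkh j a]
    exact integral_nonneg fun _ => by positivity
  · intro a ha
    exact birChain_diag_re_pos hkc' hkR hG0 hGs hkh hkne' (hS a ha) j
  · rw [hZ, hint]
  · rw [hN, ← integral_complex_ofReal]
    refine integral_congr_ae (Filter.Eventually.of_forall fun a => ?_)
    show _ = (((_ * (G (2 * j + 1) a a).re : ℝ)) : ℂ)
    rw [Complex.ofReal_mul, ← hdiag a]

/-- **Even temporal extent: the partition function is positive (`r = 2`, class (R)).** For the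
objects of `BirComplexStableXY` with `r = 2`, every real `K`, every `L ≥ 1`, every Fourier table
satisfying (R) and every even `M ≥ 1`, the partition function `Z = ∫_{[0,2π]^Λ} exp(-A θ) dθ`
is a strictly positive real number; in particular `Z ≠ 0` — the first conjunct of the engine
holds at even `M` throughout the time-reflection class, with no smallness condition. -/
theorem birEven_partitionFunction_pos (c : ((Fin 2 × Fin 2 × Fin 2) → ℤ) →₀ ℂ) (K : ℝ) (L M : ℕ)
    [NeZero L] [NeZero M]
    (hR : ∀ φ : (Fin 2 × Fin 2 × Fin 2) → ℝ,
      c.sum (fun n a => a * Complex.exp (Complex.I *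
        ((∑ w, (n w : ℝ) * φ (w.1, w.2.1, Fin.rev w.2.2) : ℝ) : ℂ))) =
      conj (c.sum (fun n a => a * Complex.exp (Complex.I * ((∑ w, (n w : ℝ) * φ w : ℝ) : ℂ)))))
    (hM : Even M) :
    let sh : (TorusSite 2 L × ZMod M) → (Fin 2 × Fin 2 × Fin 2) → (TorusSite 2 L × ZMod M) :=
      fun s w => (s.1 + ![((w.1 : ℕ) : ZMod L), ((w.2.1 : ℕ) : ZMod L)], s.2 + ((w.2.2 : ℕ) : ZMod M))
    let F : ((Fin 2 × Fin 2 × Fin 2) → ℝ) → ℂ := fun φ =>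
      c.sum (fun n a => a * Complex.exp (Complex.I * ((∑ w, (n w : ℝ) * φ w : ℝ) : ℂ)))
    let A : ((TorusSite 2 L × ZMod M) → ℝ) → ℂ := fun θ => (K : ℂ) * ∑ s, F (fun w => θ (sh s w))
    let cube : Set ((TorusSite 2 L × ZMod M) → ℝ) := Set.pi Set.univ (fun _ => Set.Icc (0:ℝ) (2 * Real.pi))
    let Z : ℂ := MeasureTheory.integral (MeasureTheory.volume.restrict cube) (fun θ => Complex.exp (-(A θ)))
    0 < Z.re ∧ Z.im = 0 ∧ Z ≠ 0 := by
  intro sh F A cube Z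
  obtain ⟨ρ, -, -, -, hZ, -, hpos⟩ := birEven_positiveDensity c K L M hR hM
  have hZ' : Z = ((∫ a in Set.pi Set.univ (fun _ : TorusSite 2 L => Set.Icc (0:ℝ) (2 * Real.pi)),
      ρ a : ℝ) : ℂ) := hZ
  refine ⟨?_, ?_, ?_⟩
  · rw [hZ', Complex.ofReal_re]; exact hpos
  · rw [hZ', Complex.ofReal_im]
  · rw [hZ']; exact_mod_cast hpos.ne'

/-- **Even temporal extent: the slice-order claim is a positive-measure expectation bound.**
In the setting of `birEven_partitionFunction_pos`, the numerator `N = ∫ O e^{-A}` of the slice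
order is real with `0 ≤ N ≤ Z`, and the second conjunct of the engine,
`1/2 ≤ Re (N / Z)`, is equivalent to `Z ≤ 2 N`, i.e. to `𝔼_ρ[O_slice] ≥ 1/2` for the positive
density `ρ` of `birEven_positiveDensity`. -/
theorem birEven_sliceOrder_iff (c : ((Fin 2 × Fin 2 × Fin 2) → ℤ) →₀ ℂ) (K : ℝ) (L M : ℕ)
    [NeZero L] [NeZero M]
    (hR : ∀ φ : (Fin 2 × Fin 2 × Fin 2) → ℝ,
      c.sum (fun n a => a * Complex.exp (Complex.I *
        ((∑ w, (n w : ℝ) * φ (w.1, w.2.1, Fin.rev w.2.2) : ℝ) : ℂ))) =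
      conj (c.sum (fun n a => a * Complex.exp (Complex.I * ((∑ w, (n w : ℝ) * φ w : ℝ) : ℂ)))))
    (hM : Even M) :
    let sh : (TorusSite 2 L × ZMod M) → (Fin 2 × Fin 2 × Fin 2) → (TorusSite 2 L × ZMod M) :=
      fun s w => (s.1 + ![((w.1 : ℕ) : ZMod L), ((w.2.1 : ℕ) : ZMod L)], s.2 + ((w.2.2 : ℕ) : ZMod M))
    let F : ((Fin 2 × Fin 2 × Fin 2) → ℝ) → ℂ := fun φ =>
      c.sum (fun n a => a * Complex.exp (Complex.I * ((∑ w, (n w : ℝ) * φ w : ℝ) : ℂ)))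
    let A : ((TorusSite 2 L × ZMod M) → ℝ) → ℂ := fun θ => (K : ℂ) * ∑ s, F (fun w => θ (sh s w))
    let cube : Set ((TorusSite 2 L × ZMod M) → ℝ) := Set.pi Set.univ (fun _ => Set.Icc (0:ℝ) (2 * Real.pi))
    let Z : ℂ := MeasureTheory.integral (MeasureTheory.volume.restrict cube) (fun θ => Complex.exp (-(A θ)))
    let O : ((TorusSite 2 L × ZMod M) → ℝ) → ℝ := fun θ =>
      ‖∑ x : TorusSite 2 L, Complex.exp (Complex.I * (θ (x, 0) : ℂ))‖ ^ 2 / (L : ℝ) ^ 4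
    let N : ℂ := MeasureTheory.integral (MeasureTheory.volume.restrict cube)
      (fun θ => (O θ : ℂ) * Complex.exp (-(A θ)))
    N.im = 0 ∧ 0 ≤ N.re ∧ N.re ≤ Z.re ∧ ((1/2 : ℝ) ≤ (N / Z).re ↔ Z.re ≤ 2 * N.re) := by
  intro sh F A cube Z O N
  obtain ⟨ρ, hρc, hρ0, -, hZ, hN, hpos⟩ := birEven_positiveDensity c K L M hR hM
  set CX : Set (TorusSite 2 L → ℝ) :=
    Set.pi Set.univ (fun _ : TorusSite 2 L => Set.Icc (0:ℝ) (2 * Real.pi)) with hCX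
  have hZ' : Z = ((∫ a in CX, ρ a : ℝ) : ℂ) := hZ
  have hN' : N = ((∫ a in CX, ‖∑ x : TorusSite 2 L, Complex.exp (Complex.I * (a x : ℂ))‖ ^ 2 /
      (L : ℝ) ^ 4 * ρ a : ℝ) : ℂ) := hN
  obtain ⟨hOc, hOb⟩ := birSliceObservable_continuous_bound L
  have hCXc : IsCompact CX := isCompact_univ_pi fun _ => isCompact_Icc
  have hρi : IntegrableOn ρ CX := hρc.continuousOn.integrableOn_compact hCXc
  have hOρi : IntegrableOn (fun a => ‖∑ x : TorusSite 2 L, Complex.exp (Complex.I * (a x : ℂ))‖ ^ 2 /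
      (L : ℝ) ^ 4 * ρ a) CX := (hOc.mul hρc).continuousOn.integrableOn_compact hCXc
  have hNre : 0 ≤ ∫ a in CX, ‖∑ x : TorusSite 2 L, Complex.exp (Complex.I * (a x : ℂ))‖ ^ 2 /
      (L : ℝ) ^ 4 * ρ a := integral_nonneg fun a => mul_nonneg (hOb a).1 (hρ0 a)
  have hNZ : ∫ a in CX, ‖∑ x : TorusSite 2 L, Complex.exp (Complex.I * (a x : ℂ))‖ ^ 2 /
      (L : ℝ) ^ 4 * ρ a ≤ ∫ a in CX, ρ a := by
    refine integral_mono hOρi hρi fun a => ?_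
    have := mul_le_mul_of_nonneg_right (hOb a).2 (hρ0 a)
    simpa using this
  refine ⟨?_, ?_, ?_, ?_⟩
  · rw [hN', Complex.ofReal_im]
  · rw [hN', Complex.ofReal_re]; exact hNre
  · rw [hN', hZ', Complex.ofReal_re, Complex.ofReal_re]; exact hNZ
  · rw [hN', hZ', ← Complex.ofReal_div, Complex.ofReal_re, Complex.ofReal_re, Complex.ofReal_re,
      le_div_iff₀ hpos]
    constructor <;> intro h <;> linarith

end Main

end Summit.HubbardSuperconductivity.HubbardSuperconductivity.Theorems
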